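/-
Copyright: lit-balaban cell (HOME `run/shared/lean/pub/lit-balaban/`), Phase-2 proof seat p12 (gen 7).  Statement-level record of
a published text with the definitions it needs; nothing is claimed beyond what the kernel checks below.
-/
import Mathlib
import Literature.MathematicalPhysics.QuantumFieldTheory.Federbush1986.PureAveragesSU2

/-!
# `DybalskiStottmeisterTanimoto2024.DST24Setting` — W. Dybalski, A. Stottmeister, Y. Tanimoto, *The Bałaban variational
# problem in the non-linear sigma model*, Rev. Math. Phys. **36** (2024), arXiv:2403.09800 [DybalskiStottmeisterTanimoto2024]:
# **§1.1 «The setting and results»** (lattice, configurations, action, block averaging by polar decomposition, small-field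
# sets) with **THEOREM 1 TYPED** (`Theorem1`), and the Lie-derivative vocabulary of §3.1 ((3.3), (3.8)–(3.10)) in which
# «critical point with the constraint 𝒞(U) = V» is meant

statement-level skeleton of published theorems with citation tags; proofs where landed; nothing here is a claim about
the Yang–Mills mass gap

Source held: `paper:arxiv-2403.09800` (tex chunks; §1.1 = chunk p0006, §3.1 = p0008; the tex carries no theorem numbers except
«Theorem 1», so other items are cited by section + tex label).  Unit `lit-balaban-p12` (gen 7), free-target protocol G.5-34(d) in
the seat's own lane (BJ86 Part IV §4 and its published repair/companion [DybalskiStottmeisterTanimoto2024], cf. the cell files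
`DST24RandomWalkAppendix` (r16), `DST24NormRijLemma`/`DST24NormRijOffDiagonal` (p12 g5)); EXT companion of the SKELETON rows
`BJ.ThmCritOrbit` / `B11.Thm1` (the Bałaban variational problem): this paper is the published, complete treatment of the ONE-STEP
constrained critical-point problem for the `O(4)` non-linear sigma model («we find it worthwhile to work out in the NLSM₂ one
aspect of Bałaban's method, which is the variational problem», §1).

WHAT IS PRINTED (§1.1, verbatim up to notation).  `I := [0,1,…,n−1]`, `Ω = I^{×2} ⊂ ℤ²`, `Ω′` the oriented bonds `b = (b₋,b₊)`
of `Ω`; `L > 1` odd, `Ω₁ := (LΩ) ∩ Ω` the coarse lattice; boxes `B₁(y) := {x ∈ Ω | y_μ ≤ x_μ < y_μ + L, μ = 0,1}` (label = left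
bottom corner), `y_x` the label of the box containing `x`; `Ω′₁` the oriented bonds of `Ω₁`.  `G₀ ⊂ U(N)` a Lie group,
`Conf(Ω) := G₀^{×n²} ∋ U = {U(x)}_{x∈Ω}`; action `𝒜(U) = Σ_{b∈Ω′} Re Tr(1 − ∂U(b))`, `∂U(b) := U(b₋)U(b₊)*`; symmetry
`𝒜(uUv) = 𝒜(U)`.  Averaging: `𝒞₀(U)(y) := L⁻² Σ_{x∈B(y)} U(x)`, polar decomposition `𝒞₀(U)(y) = 𝒞(U)(y)|𝒞₀(U)(y)|`, `𝒞(U)(y) := 1`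
when `𝒞₀(U)(y) = 0`; «for `G₀ = SU(2)` … `𝒞(U)(y) ∈ G₀`» (App. B, Lemma (SU(2)-lemma)); `𝒞(uUv) = u𝒞(U)v` for block-constant
`u, v`; constraint `𝒞(U) = V`, `V ∈ Conf(Ω₁)`.  Small fields: `Conf_ε(Ω) := {U | ‖∂U(b) − 1‖ ≤ ε ∀ b ∈ Ω′}`, `0 < ε ≤ 1`.
**Theorem 1.** *Let `G₀ = SU(2)`. Then there exist `0 < ε, ε₁ ≤ 1` s.t. for `V ∈ Conf_{ε₁}(Ω₁)` the action `𝒜` has a unique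
critical point over `Conf_ε(Ω)` with the constraint `𝒞(U) = V`. The parameters `ε, ε₁` are independent of `n` but may depend on
`L`.*  Remark 1.1(2): «As the open set `G_ε`, on which the Lie derivatives will be computed, we take the interior of `Conf_ε(Ω)`»;
(4): `Conf^{ε′}(Ω) := {U | ‖U(x) − 1‖ ≤ ε′ ∀ x}`; (SU2) `e^{ia(n̂·σ⃗)} = cos a + i(n̂·σ⃗) sin a`, `U′(x) = δA₀(x) + iA⃗(x)·σ⃗`,
`δ = sgn cos a`, `A₀ = √(1 − |A⃗|²)`, `Conf⃗^ε(Ω) := {{A⃗(x)} | A⃗(x) ∈ ℝ³, sup_x |A⃗(x)| ≤ ε}`.  §3.1: flow `γ_t(U) = e^{itX}U` (3.8),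
`(𝓛_X F)(U₀) = d/dt F(e^{itX}U₀)|_{t=0} = 0` (3.9) «for all `X ∈ T_{U₀}M_C`. Such `X` can be characterized by the conditions
`(𝓛_X C_j)(U₀) = d/dt C_j(e^{itX}U₀)|_{t=0} = 0`» (3.10).

HOW IT IS TYPED (model choices, stated once).
* `G₀ = SU(2)` is the tree's unit-quaternion carrier `Federbush1986.SU2` (`q ∈ ℍ`, `‖q‖ = 1`; Lie algebra `su2 = Im ℍ`, `expSU2`),
  under the real-algebra isomorphism `e_j ↦ −iσ_j` (so `U′ = A₀ + iA⃗·σ⃗ ↔ q = A₀ − A⃗`, i.e. **`A⃗ = −Im q`** as an element of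
  `Im ℍ ≅ ℝ³`; with this dictionary every displayed product formula of the paper holds verbatim, the cross product of `ℝ³` being
  `Im(ab)` on `Im ℍ`).  Print's `‖·‖` (operator norm of `2×2` matrices) IS the quaternion norm (a quaternion acts on `ℂ²` as
  `|q|`·unitary), and `Tr M = 2 Re q`; so `Re Tr(1 − ∂U(b)) = 2(1 − Re q(b₋)q(b₊)*)`.
* The lattice: `n = L·n₁` sites per direction (`Site L n₁ = Fin 2 → Fin (L·n₁)`), coarse labels `CSite n₁ = Fin 2 → Fin n₁`
  (print's label is the corner `L·j`; we carry `j`).  READING NOTE (not an erratum claim): the Notation section prints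
  «`n − 1 = L^m`», but §1.1's boxes of side `L` tile `Ω` and (2.6) «`Q*Q` is the projection on block-constant functions» hold
  exactly when `L ∣ n`; we type `n = L·n₁`, which is what every display from (2.5) on uses.  Bonds `Ω′` = the positively
  oriented nearest-neighbour pairs `(x, x + e_μ)` («according to the orientation of `Ω`», §3.3).
* Lie derivatives (3.3)/(3.9) are `deriv` at `t = 0` along the flow (3.8); the tangency conditions (3.10) for the constraint
  `𝒞(U) = V` are stated intrinsically: `d/dt 𝒞(e^{itX}U)(y)|_{t=0} = 0` in `ℍ` for every `y` (as `HasDerivAt … 0 0`: the derivative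
  exists and vanishes — print's `C_j ∈ C¹`).  That these are the conditions `𝓛_X c′(U′)(y) = 0` of §3.2 at points of the
  constraint manifold is proved downstream.

WHAT IS HERE.  Definitions with bodies: `Site`, `CSite`, `blk` (`y_x`), `box` (`B₁(y)`), `siteOf`, `Bond`/`CBond` (`Ω′`, `Ω′₁`)
with `src`/`tgt` (`b₋`, `b₊`), `Conf`/`CConf`, `pd` (`∂U(b)`), `pdC` (`∂V(c)`), `action` (`𝒜`), `C0` (`𝒞₀`), `avg` (`𝒞`),
`smallField`/`smallFieldC` (`Conf_ε`), `nearOne` (`Conf^{ε′}`), `vecOf` (`A⃗ = −Im q`), `A0` (`A₀`), `sgn` (`δ`), `vecConf`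
(`Conf⃗^ε`), `flow` (3.8), `lieDeriv` (3.3)/(3.9), `IsTangent` (3.10), `IsConstrainedCritical`, **`Theorem1`** (Theorem 1,
TYPED, not proved here).  Proved API: `mem_box_iff`/`card_box` (`|B₁(y)| = L²`), `sum_eq_sum_box`, the symmetry `action_conj`
(`𝒜(uUv) = 𝒜(U)`), the polar decomposition `C0_eq_avg_mul` / `star_C0_mul_C0` (App. B Lemma (SU(2)-lemma): `𝒞₀ = 𝒞·|𝒞₀|`,
`𝒞 ∈ SU(2)`), `avg_conj` (`𝒞(uUv) = u𝒞(U)v` where `𝒞₀ ≠ 0`), `norm_val_sub_one_sq` (`‖q − 1‖² = 2(1 − Re q)`), `flow_zero`,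
`one_mem_smallField`.  No `sorry`; the one `Prop` definition without proof is the typed Theorem 1 (`Theorem1`), the target of
this programme.
-/

namespace Literature.MathematicalPhysics.QuantumFieldTheory.DybalskiStottmeisterTanimoto2024.DST24Setting

open scoped Quaternion RealInnerProductSpace BigOperators
open Literature.MathematicalPhysics.QuantumFieldTheory.Federbush1986

noncomputable section

/-! ## §1.1 The lattice `Ω`, the coarse lattice `Ω₁`, boxes `B₁(y)` and bonds `Ω′` -/

/-- Sites of `Ω = I^{×2}`, `I = [0,1,…,n−1]`, with `n = L·n₁` (reading note in the header). [cite: DybalskiStottmeisterTanimoto2024, §1.1 (Ω = I^{×2})] -/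
abbrev Site (L n₁ : ℕ) : Type := Fin 2 → Fin (L * n₁)

/-- Labels of the coarse lattice `Ω₁ = (LΩ) ∩ Ω` (the label `j` stands for print's corner `y = L·j`). [cite: DybalskiStottmeisterTanimoto2024, §1.1 (Ω₁ := (LΩ) ∩ Ω)] -/
abbrev CSite (n₁ : ℕ) : Type := Fin 2 → Fin n₁

/-- The oriented bonds `Ω′ ∋ b = (b₋, b₊)`, `b₊ = b₋ + e_μ` (positively oriented nearest-neighbour pairs of `Ω`).
[cite: DybalskiStottmeisterTanimoto2024, §1.1 (Ω′)] -/
abbrev Bond (L n₁ : ℕ) : Type := {p : Site L n₁ × Fin 2 // (p.1 p.2 : ℕ) + 1 < L * n₁}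

/-- The oriented bonds `Ω′₁` of the coarse lattice. [cite: DybalskiStottmeisterTanimoto2024, §1.1 (Ω′₁)] -/
abbrev CBond (n₁ : ℕ) : Type := {p : CSite n₁ × Fin 2 // (p.1 p.2 : ℕ) + 1 < n₁}

/-- `Conf(Ω) = G₀^{×n²}`, `G₀ = SU(2)` (unit quaternions). [cite: DybalskiStottmeisterTanimoto2024, §1.1 (Conf(Ω))] -/
abbrev Conf (L n₁ : ℕ) : Type := Site L n₁ → SU2

/-- `Conf(Ω₁)` (the constraint data `V`). [cite: DybalskiStottmeisterTanimoto2024, §1.1 (V ∈ Conf(Ω₁))] -/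
abbrev CConf (n₁ : ℕ) : Type := CSite n₁ → SU2

variable {L n₁ : ℕ}

/-- `y_x`: the label of the box containing `x`, `(y_x)_μ = ⌊x_μ/L⌋`. [cite: DybalskiStottmeisterTanimoto2024, §1.1 (B₁(y), y_x)] -/
def blk (x : Site L n₁) : CSite n₁ := fun μ => ⟨(x μ : ℕ) / L, Nat.div_lt_of_lt_mul (x μ).isLt⟩

/-- [cite: DybalskiStottmeisterTanimoto2024, §1.1 (y_x)] -/
theorem blk_apply (x : Site L n₁) (μ : Fin 2) : ((blk x μ : Fin n₁) : ℕ) = (x μ : ℕ) / L := rfl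

/-- The box `B₁(y) = {x ∈ Ω | y_μ ≤ x_μ < y_μ + L, μ = 0,1}` as a finite set. [cite: DybalskiStottmeisterTanimoto2024, §1.1 (B₁(y))] -/
def box (L : ℕ) (y : CSite n₁) : Finset (Site L n₁) := Finset.univ.filter fun x => blk x = y

/-- [cite: DybalskiStottmeisterTanimoto2024, §1.1 (B₁(y))] -/
theorem mem_box {y : CSite n₁} {x : Site L n₁} : x ∈ box L y ↔ blk x = y := by
  simp [box]

/-- [cite: DybalskiStottmeisterTanimoto2024, §1.1 (y_x)] -/
theorem mem_box_blk (x : Site L n₁) : x ∈ box L (blk x) := mem_box.mpr rfl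

/-- `x ∈ B₁(y)` in print's form `y_μ ≤ x_μ < y_μ + L` with corner `y_μ = L·j_μ`. [cite: DybalskiStottmeisterTanimoto2024, §1.1 (B₁(y))] -/
theorem mem_box_iff (hL : 0 < L) {y : CSite n₁} {x : Site L n₁} :
    x ∈ box L y ↔ ∀ μ, L * (y μ : ℕ) ≤ (x μ : ℕ) ∧ (x μ : ℕ) < L * (y μ : ℕ) + L := by
  rw [mem_box]
  constructor
  · intro h μ
    have h1 : (x μ : ℕ) / L = (y μ : ℕ) := by rw [← h]; rfl
    rw [← h1, mul_comm]
    exact ⟨Nat.div_mul_le_self _ _, Nat.lt_div_mul_add hL⟩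
  · intro h
    funext μ
    apply Fin.ext
    rw [blk_apply]
    obtain ⟨h1, h2⟩ := h μ
    apply Nat.div_eq_of_lt_le
    · simpa only [Nat.mul_comm (y μ : ℕ) L] using h1
    · have e : ((y μ : ℕ) + 1) * L = L * (y μ : ℕ) + L := by ring
      simpa only [e] using h2

/-- The site of `B₁(y)` with in-box position `u`: `x_μ = L y_μ + u_μ`. [cite: DybalskiStottmeisterTanimoto2024, §1.1 (B₁(y))] -/
def siteOf (y : CSite n₁) (u : Fin 2 → Fin L) : Site L n₁ := fun μ =>
  ⟨L * (y μ : ℕ) + u μ, by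
    have hy := (y μ).isLt
    have hu := (u μ).isLt
    calc L * (y μ : ℕ) + u μ < L * (y μ : ℕ) + L := by omega
      _ = L * ((y μ : ℕ) + 1) := by ring
      _ ≤ L * n₁ := Nat.mul_le_mul_left _ hy⟩

/-- [cite: DybalskiStottmeisterTanimoto2024, §1.1 (B₁(y))] -/
theorem siteOf_apply (y : CSite n₁) (u : Fin 2 → Fin L) (μ : Fin 2) :
    ((siteOf y u μ : Fin (L * n₁)) : ℕ) = L * (y μ : ℕ) + u μ := rfl

/-- [cite: DybalskiStottmeisterTanimoto2024, §1.1 (B₁(y), y_x)] -/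
theorem blk_siteOf (y : CSite n₁) (u : Fin 2 → Fin L) : blk (siteOf y u) = y := by
  funext μ
  apply Fin.ext
  rw [blk_apply, siteOf_apply]
  have hL : 0 < L := Nat.pos_of_ne_zero (by rintro rfl; exact absurd (u μ).isLt (by simp))
  rw [Nat.mul_add_div hL, Nat.div_eq_of_lt (u μ).isLt, add_zero]

/-- [cite: DybalskiStottmeisterTanimoto2024, §1.1 (B₁(y))] -/
theorem siteOf_injective (y : CSite n₁) : Function.Injective (siteOf y : (Fin 2 → Fin L) → Site L n₁) := by
  intro u v h
  funext μ
  have h1 := congrArg (fun x : Site L n₁ => ((x μ : Fin (L * n₁)) : ℕ)) h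
  simp only [siteOf_apply] at h1
  exact Fin.ext (by omega)

/-- Every site of `B₁(y)` has the form `L y + u`. [cite: DybalskiStottmeisterTanimoto2024, §1.1 (B₁(y))] -/
theorem exists_siteOf_of_mem_box {y : CSite n₁} {x : Site L n₁} (hx : x ∈ box L y) :
    ∃ u : Fin 2 → Fin L, siteOf y u = x := by
  have hL : 0 < L := Nat.pos_of_ne_zero (by rintro rfl; exact absurd (x 0).isLt (by simp))
  rw [mem_box] at hx
  refine ⟨fun μ => ⟨(x μ : ℕ) % L, Nat.mod_lt _ hL⟩, ?_⟩
  funext μ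
  apply Fin.ext
  rw [siteOf_apply]
  have h1 : (x μ : ℕ) / L = (y μ : ℕ) := by rw [← hx]; rfl
  rw [← h1]
  exact Nat.div_add_mod _ _

/-- `B₁(y)` is the image of the in-box positions. [cite: DybalskiStottmeisterTanimoto2024, §1.1 (B₁(y))] -/
theorem box_eq_image (y : CSite n₁) : box L y = Finset.univ.image (siteOf y) := by
  ext x
  constructor
  · intro hx
    obtain ⟨u, rfl⟩ := exists_siteOf_of_mem_box hx
    exact Finset.mem_image_of_mem _ (Finset.mem_univ _)
  · intro hx
    obtain ⟨u, -, rfl⟩ := Finset.mem_image.mp hx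
    exact mem_box.mpr (blk_siteOf y u)

/-- `|B₁(y)| = L²`. [cite: DybalskiStottmeisterTanimoto2024, §1.1 (B₁(y)), (2.6)] -/
theorem card_box (y : CSite n₁) : (box L y).card = L ^ 2 := by
  rw [box_eq_image, Finset.card_image_of_injective _ (siteOf_injective y), Finset.card_univ, Fintype.card_fun,
    Fintype.card_fin, Fintype.card_fin]

/-- Sums over `Ω` block by block: `Σ_x f(x) = Σ_y Σ_{x∈B₁(y)} f(x)`. [cite: DybalskiStottmeisterTanimoto2024, §1.1 (B₁(y))] -/
theorem sum_eq_sum_box {M : Type*} [AddCommMonoid M] (f : Site L n₁ → M) :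
    ∑ x, f x = ∑ y, ∑ x ∈ box L y, f x := by
  rw [← Finset.sum_fiberwise_of_maps_to (s := Finset.univ) (t := Finset.univ) (g := blk)
    (fun x _ => Finset.mem_univ (blk x)) f]
  rfl

namespace Bond

variable (b : Bond L n₁)

/-- `b₋`. [cite: DybalskiStottmeisterTanimoto2024, §1.1 (b = (b₋,b₊))] -/
def src : Site L n₁ := b.1.1

/-- the direction `μ` of `b`. [cite: DybalskiStottmeisterTanimoto2024, §1.1 (Ω′)] -/
def dir : Fin 2 := b.1.2

/-- `b₊ = b₋ + e_μ`. [cite: DybalskiStottmeisterTanimoto2024, §1.1 (b = (b₋,b₊))] -/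
def tgt : Site L n₁ := Function.update b.1.1 b.1.2 ⟨(b.1.1 b.1.2 : ℕ) + 1, b.2⟩

/-- [cite: DybalskiStottmeisterTanimoto2024, §1.1 (b = (b₋,b₊))] -/
theorem tgt_apply_dir : ((b.tgt b.dir : Fin (L * n₁)) : ℕ) = (b.src b.dir : ℕ) + 1 := by
  simp [tgt, src, dir]

/-- [cite: DybalskiStottmeisterTanimoto2024, §1.1 (b = (b₋,b₊))] -/
theorem tgt_apply_of_ne {μ : Fin 2} (h : μ ≠ b.dir) : b.tgt μ = b.src μ :=
  Function.update_of_ne h _ _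

end Bond

namespace CBond

variable (c : CBond n₁)

/-- `c₋`. [cite: DybalskiStottmeisterTanimoto2024, §1.1 (Ω′₁)] -/
def src : CSite n₁ := c.1.1

/-- the direction of `c`. [cite: DybalskiStottmeisterTanimoto2024, §1.1 (Ω′₁)] -/
def dir : Fin 2 := c.1.2

/-- `c₊ = c₋ + e_μ`. [cite: DybalskiStottmeisterTanimoto2024, §1.1 (Ω′₁)] -/
def tgt : CSite n₁ := Function.update c.1.1 c.1.2 ⟨(c.1.1 c.1.2 : ℕ) + 1, c.2⟩

end CBond

/-! ## Configurations, the action, its symmetry -/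

/-- `∂U(b) := U(b₋)U(b₊)*` (for a unit quaternion `q* = q⁻¹`). [cite: DybalskiStottmeisterTanimoto2024, §1.1 (∂U(b) := U(b₋)U(b₊)*)] -/
def pd (U : Conf L n₁) (b : Bond L n₁) : SU2 := U b.src * (U b.tgt)⁻¹

/-- `∂V(c) := V(c₋)V(c₊)*` on the coarse lattice (for `Conf_{ε₁}(Ω₁)`). [cite: DybalskiStottmeisterTanimoto2024, §1.1 (Conf_{ε₁}(Ω₁))] -/
def pdC (V : CConf n₁) (c : CBond n₁) : SU2 := V c.src * (V c.tgt)⁻¹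

/-- [cite: DybalskiStottmeisterTanimoto2024, §1.1 (∂U(b))] -/
theorem pd_val (U : Conf L n₁) (b : Bond L n₁) : (pd U b).val = (U b.src).val * star (U b.tgt).val := rfl

/-- [cite: DybalskiStottmeisterTanimoto2024, §1.1 (Conf_{ε₁}(Ω₁))] -/
theorem pdC_val (V : CConf n₁) (c : CBond n₁) : (pdC V c).val = (V c.src).val * star (V c.tgt).val := rfl

/-- The action `𝒜(U) = Σ_{b∈Ω′} Re Tr(1 − ∂U(b))`; `Tr` of the `2×2` matrix of a quaternion `q` is `2 Re q`.
[cite: DybalskiStottmeisterTanimoto2024, §1.1 (𝒜(U) = Σ_b Re Tr(1 − ∂U(b)))] -/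
def action (U : Conf L n₁) : ℝ := ∑ b : Bond L n₁, 2 * (1 - (pd U b).val.re)

/-- `Re(u q u*) = Re q` for a unit quaternion `u`. [cite: DybalskiStottmeisterTanimoto2024, §1.1 (𝒜(uUv) = 𝒜(U))] -/
theorem re_conj_unit (u : SU2) (q : ℍ) : (u.val * q * star u.val).re = q.re := by
  rw [SU2.re_conj, SU2.normSq_val, one_mul]

/-- **Symmetry of the action**: `𝒜(uUv) = 𝒜(U)` for `x`-independent `u, v ∈ SU(2)`. [cite: DybalskiStottmeisterTanimoto2024, §1.1 (𝒜(uUv) = 𝒜(U))] -/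
theorem action_conj (u v : SU2) (U : Conf L n₁) : action (fun x => u * U x * v) = action U := by
  unfold action
  refine Finset.sum_congr rfl fun b _ => ?_
  congr 2
  rw [pd_val, pd_val]
  simp only [SU2.mul_val, star_mul]
  have : u.val * (U b.src).val * v.val * (star v.val * (star (U b.tgt).val * star u.val)) =
      u.val * ((U b.src).val * (v.val * star v.val) * star (U b.tgt).val) * star u.val := by
    simp only [mul_assoc]
  rw [this, SU2.val_mul_star_val, mul_one, re_conj_unit]

/-- The action is non-negative (`Re q ≤ 1` on `SU(2)`). [cite: DybalskiStottmeisterTanimoto2024, §1.1 (𝒜(U))] -/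
theorem action_nonneg (U : Conf L n₁) : 0 ≤ action U :=
  Finset.sum_nonneg fun b _ => mul_nonneg zero_le_two (sub_nonneg.mpr (SU2.re_le_one (pd U b)))

/-! ## Block averaging by polar decomposition -/

/-- `𝒞₀(U)(y) := L⁻² Σ_{x∈B(y)} U(x)` (a quaternion, in general not of unit norm). [cite: DybalskiStottmeisterTanimoto2024, §1.1 (𝒞₀(U)(y))] -/
def C0 (U : Conf L n₁) (y : CSite n₁) : ℍ := ((L : ℝ) ^ 2)⁻¹ • ∑ x ∈ box L y, (U x).val

/-- `‖‖q‖⁻¹ q‖ = 1` for `q ≠ 0`. [cite: DybalskiStottmeisterTanimoto2024, §1.1 (polar decomposition)] -/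
theorem norm_inv_norm_smul {q : ℍ} (hq : q ≠ 0) : ‖(‖q‖⁻¹ : ℝ) • q‖ = 1 := by
  rw [norm_smul, norm_inv, norm_norm, inv_mul_cancel₀ (norm_ne_zero_iff.mpr hq)]

/-- **The averaging operation** `𝒞(U)(y)`: the partial isometry of the polar decomposition
`𝒞₀(U)(y) = 𝒞(U)(y)|𝒞₀(U)(y)|`, with `𝒞(U)(y) := 1` whenever `𝒞₀(U)(y) = 0`.  For quaternions `|M| = (M*M)^{1/2} = ‖M‖` is a
scalar, so `𝒞 = M/‖M‖ ∈ SU(2)` (App. B, Lemma (SU(2)-lemma)). [cite: DybalskiStottmeisterTanimoto2024, §1.1 (𝒞(U)(y))] -/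
def avg (U : Conf L n₁) (y : CSite n₁) : SU2 :=
  open Classical in
  if h : C0 U y = 0 then 1 else ⟨(‖C0 U y‖⁻¹ : ℝ) • C0 U y, norm_inv_norm_smul h⟩

/-- [cite: DybalskiStottmeisterTanimoto2024, §1.1 (𝒞(U)(y) := 1 if 𝒞₀(U)(y) = 0)] -/
theorem avg_of_eq_zero {U : Conf L n₁} {y : CSite n₁} (h : C0 U y = 0) : avg U y = 1 := by
  rw [avg, dif_pos h]

/-- [cite: DybalskiStottmeisterTanimoto2024, §1.1 (𝒞(U)(y))] -/
theorem avg_val_of_ne_zero {U : Conf L n₁} {y : CSite n₁} (h : C0 U y ≠ 0) :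
    (avg U y).val = (‖C0 U y‖⁻¹ : ℝ) • C0 U y := by
  rw [avg, dif_neg h]

/-- `M*M = |M|²·1` for a quaternion: the modulus of the polar decomposition of `𝒞₀` is the scalar `‖𝒞₀‖`
(App. B Lemma (SU(2)-lemma): «`𝒞₀(U)(y) = cU` for some `U ∈ SU(2)` and `c ≥ 0`»). [cite: DybalskiStottmeisterTanimoto2024, App. B Lemma (SU(2)-lemma)] -/
theorem star_C0_mul_C0 (U : Conf L n₁) (y : CSite n₁) :
    star (C0 U y) * C0 U y = ((‖C0 U y‖ ^ 2 : ℝ) : ℍ) := by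
  rw [Quaternion.star_mul_self, Quaternion.normSq_eq_norm_mul_self, pow_two]

/-- **Polar decomposition** `𝒞₀(U)(y) = 𝒞(U)(y)·|𝒞₀(U)(y)|` with `𝒞(U)(y) ∈ SU(2)` (both cases of the definition).
[cite: DybalskiStottmeisterTanimoto2024, §1.1 (𝒞₀ = 𝒞|𝒞₀|), App. B Lemma (SU(2)-lemma)] -/
theorem C0_eq_avg_mul (U : Conf L n₁) (y : CSite n₁) : C0 U y = (avg U y).val * ((‖C0 U y‖ : ℝ) : ℍ) := by
  by_cases h : C0 U y = 0
  · rw [h, norm_zero, Quaternion.coe_zero, mul_zero]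
  · rw [avg_val_of_ne_zero h, smul_mul_assoc, ← Quaternion.coe_commutes, Quaternion.coe_mul_eq_smul, smul_smul,
      inv_mul_cancel₀ (norm_ne_zero_iff.mpr h), one_smul]

/-- `𝒞₀(uUv) = u𝒞₀(U)v`. [cite: DybalskiStottmeisterTanimoto2024, §1.1 (𝒞(uUv) = u𝒞(U)v)] -/
theorem C0_conj (u v : SU2) (U : Conf L n₁) (y : CSite n₁) :
    C0 (fun x => u * U x * v) y = u.val * C0 U y * v.val := by
  unfold C0
  simp only [SU2.mul_val]
  rw [mul_smul_comm, smul_mul_assoc, Finset.mul_sum, Finset.sum_mul]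

/-- **`𝒞(uUv) = u𝒞(U)v`** for `x`-independent (block-constant on the block in question) `u, v ∈ SU(2)`, wherever the polar part
is determined by `𝒞₀ ≠ 0` (print states it for the generic case; at `𝒞₀ = 0` both sides are the convention `1` resp. `uv`).
[cite: DybalskiStottmeisterTanimoto2024, §1.1 (𝒞(uUv) = u𝒞(U)v)] -/
theorem avg_conj (u v : SU2) (U : Conf L n₁) (y : CSite n₁) (h : C0 U y ≠ 0) :
    avg (fun x => u * U x * v) y = u * avg U y * v := by
  have hne : C0 (fun x => u * U x * v) y ≠ 0 := by
    rw [C0_conj]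
    exact mul_ne_zero (mul_ne_zero u.val_ne_zero h) v.val_ne_zero
  apply SU2.ext
  rw [avg_val_of_ne_zero hne, SU2.mul_val, SU2.mul_val, avg_val_of_ne_zero h, C0_conj, norm_mul, norm_mul,
    u.norm_val, v.norm_val, one_mul, mul_one, mul_smul_comm, smul_mul_assoc]

/-! ## Small-field sets and the `(A₀, A⃗)` parametrisation -/

/-- `Conf_ε(Ω) := {U ∈ Conf(Ω) | ‖∂U(b) − 1‖ ≤ ε for all b ∈ Ω′}` (the small field condition). [cite: DybalskiStottmeisterTanimoto2024, §1.1 (Conf_ε(Ω))] -/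
def smallField (ε : ℝ) : Set (Conf L n₁) := {U | ∀ b : Bond L n₁, ‖(pd U b).val - 1‖ ≤ ε}

/-- `Conf_{ε₁}(Ω₁)` on the coarse lattice. [cite: DybalskiStottmeisterTanimoto2024, §1.1 (V ∈ Conf_{ε₁}(Ω₁))] -/
def smallFieldC (ε₁ : ℝ) : Set (CConf n₁) := {V | ∀ c : CBond n₁, ‖(pdC V c).val - 1‖ ≤ ε₁}

/-- `Conf^{ε′}(Ω) := {U ∈ Conf(Ω) | ‖U(x) − 1‖ ≤ ε′ for all x ∈ Ω}`. [cite: DybalskiStottmeisterTanimoto2024, §1.1 Remark 1.1 (Conf^{ε′}(Ω))] -/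
def nearOne (ε' : ℝ) : Set (Conf L n₁) := {U | ∀ x, ‖(U x).val - 1‖ ≤ ε'}

/-- [cite: DybalskiStottmeisterTanimoto2024, §1.1 (Conf_ε(Ω))] -/
theorem mem_smallField {ε : ℝ} {U : Conf L n₁} : U ∈ smallField ε ↔ ∀ b, ‖(pd U b).val - 1‖ ≤ ε := Iff.rfl

/-- [cite: DybalskiStottmeisterTanimoto2024, §1.1 (Conf_{ε₁}(Ω₁))] -/
theorem mem_smallFieldC {ε₁ : ℝ} {V : CConf n₁} : V ∈ smallFieldC ε₁ ↔ ∀ c, ‖(pdC V c).val - 1‖ ≤ ε₁ := Iff.rfl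

/-- [cite: DybalskiStottmeisterTanimoto2024, §1.1 Remark 1.1 (Conf^{ε′}(Ω))] -/
theorem mem_nearOne {ε' : ℝ} {U : Conf L n₁} : U ∈ nearOne ε' ↔ ∀ x, ‖(U x).val - 1‖ ≤ ε' := Iff.rfl

/-- Non-vacuity: the vacuum `U ≡ 1` lies in every `Conf_ε(Ω)`, `ε ≥ 0`. [cite: DybalskiStottmeisterTanimoto2024, §1.1 (Conf_ε(Ω))] -/
theorem one_mem_smallField {ε : ℝ} (hε : 0 ≤ ε) : (fun _ => (1 : SU2)) ∈ smallField (L := L) (n₁ := n₁) ε := by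
  intro b
  simp [pd, hε]

/-- `‖q − 1‖² = 2(1 − Re q)` on `SU(2)` — the link between the small-field norm and the plaquette-type term of `𝒜`; in print's
parametrisation `‖e^{ia(n̂·σ⃗)} − 1‖² = 2 − 2cos a` (§2.2, proof of Lemma (A-theorem)). [cite: DybalskiStottmeisterTanimoto2024, §2.2 Lemma (A-theorem), proof] -/
theorem norm_val_sub_one_sq (q : SU2) : ‖q.val - 1‖ ^ 2 = 2 * (1 - q.val.re) := by
  rw [← real_inner_self_eq_norm_sq, real_inner_sub_sub_self, real_inner_self_eq_norm_sq, real_inner_self_eq_norm_sq,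
    q.norm_val, norm_one, Quaternion.inner_def, star_one, mul_one]
  ring

/-- `A⃗ = −Im q ∈ Im ℍ ≅ ℝ³`: the vector of print's parametrisation `U′ = δA₀ + iA⃗·σ⃗` under `e_j ↔ −iσ_j` (header).
[cite: DybalskiStottmeisterTanimoto2024, §1.1 (SU2)/(Pauli-matrices-decomposition)] -/
def vecOf (q : ℍ) : su2 := ⟨-q.im, by
  show (-q.im).re = 0
  rw [Quaternion.re_neg, Quaternion.re_im, neg_zero]⟩

/-- [cite: DybalskiStottmeisterTanimoto2024, §1.1 (Pauli-matrices-decomposition)] -/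
@[simp] theorem vecOf_coe (q : ℍ) : (vecOf q : ℍ) = -q.im := rfl

/-- `|A⃗| = ‖Im q‖`. [cite: DybalskiStottmeisterTanimoto2024, §1.1 (Pauli-matrices-decomposition)] -/
theorem norm_vecOf (q : ℍ) : ‖vecOf q‖ = ‖q.im‖ := by
  rw [← su2.norm_coe, vecOf_coe, norm_neg]

/-- `A₀ := √(1 − |A⃗|²)` (so that `δA₀ = Re U′`, `δ = sgn cos a`). [cite: DybalskiStottmeisterTanimoto2024, §1.1 (A₀(x) := √(1 − |A⃗(x)|²))] -/
def A0 (A : su2) : ℝ := Real.sqrt (1 - ‖A‖ ^ 2)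

/-- `δ := sgn(cos a) = sgn Re U′` (print's two-valued sign; `SignType` also records the boundary case `Re U′ = 0`).
[cite: DybalskiStottmeisterTanimoto2024, §1.1 (δ := sgn(cos a))] -/
def sgn (q : SU2) : SignType := SignType.sign q.val.re

/-- On `SU(2)`: `Re q = δ·A₀(A⃗)` with `A⃗ = −Im q`, i.e. `|Re q| = √(1 − |A⃗|²)`. [cite: DybalskiStottmeisterTanimoto2024, §1.1 (Pauli-matrices-decomposition)] -/
theorem abs_re_eq_A0 (q : SU2) : |q.val.re| = A0 (vecOf q.val) := by
  rw [A0, norm_vecOf, SU2.norm_im_sq, sub_sub_cancel, Real.sqrt_sq_eq_abs]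

/-- `|A⃗| ≤ 1` on `SU(2)`. [cite: DybalskiStottmeisterTanimoto2024, §1.1 (|A⃗(x)| ≤ 1)] -/
theorem norm_vecOf_le_one (q : SU2) : ‖vecOf q.val‖ ≤ 1 := by
  rw [norm_vecOf]
  have h := SU2.norm_im_sq q
  nlinarith [sq_nonneg q.val.re, norm_nonneg q.val.im]

/-- `Conf⃗^ε(Ω) := {{A⃗(x)}_{x∈Ω} | A⃗(x) ∈ ℝ³, sup_x |A⃗(x)| ≤ ε}`. [cite: DybalskiStottmeisterTanimoto2024, §1.1 (Conf⃗^ε(Ω))] -/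
def vecConf (ε : ℝ) : Set (Site L n₁ → su2) := {A | ∀ x, ‖A x‖ ≤ ε}

/-- [cite: DybalskiStottmeisterTanimoto2024, §1.1 (Conf⃗^ε(Ω))] -/
theorem mem_vecConf {ε : ℝ} {A : Site L n₁ → su2} : A ∈ vecConf ε ↔ ∀ x, ‖A x‖ ≤ ε := Iff.rfl

/-! ## §3.1 Flows, Lie derivatives, tangency to the constraint manifold, critical points; THEOREM 1 typed -/

/-- The flow `γ_t(U) = e^{itX}U` of a Lie algebra element `iX ∈ 𝔤₀^{⊕n²}` (here `X : Ω → Im ℍ`, sitewise left multiplication).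
[cite: DybalskiStottmeisterTanimoto2024, §3.1 (3.8)] -/
def flow (X : Site L n₁ → su2) (t : ℝ) (U : Conf L n₁) : Conf L n₁ := fun x => expSU2 (t • X x) * U x

/-- `γ₀ = id`. [cite: DybalskiStottmeisterTanimoto2024, §3.1 (3.8)] -/
@[simp] theorem flow_zero (X : Site L n₁ → su2) (U : Conf L n₁) : flow X 0 U = U := by
  funext x
  simp [flow]

/-- The Lie derivative `(𝓛_X F)(U) = d/dt F(e^{itX}U)|_{t=0}` of a function on configurations with values in a real normed
space ((3.3) with the flow (3.8); (3.9) is `𝓛_X F(U₀) = 0`). [cite: DybalskiStottmeisterTanimoto2024, §3.1 (3.3), (3.9)] -/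
def lieDeriv {E : Type*} [NormedAddCommGroup E] [NormedSpace ℝ E] (X : Site L n₁ → su2) (F : Conf L n₁ → E)
    (U : Conf L n₁) : E :=
  deriv (fun t : ℝ => F (flow X t U)) 0

/-- Tangency of `X` to the constraint manifold `{𝒞(U) = V}` at `U` — (3.10) «`(𝓛_X C_j)(U₀) = d/dt C_j(e^{itX}U₀)|_{t=0} = 0`»
for the constraint map `U ↦ 𝒞(U)(y) ∈ SU(2) ⊂ ℍ`, all `y ∈ Ω₁` (the derivative exists and vanishes).
[cite: DybalskiStottmeisterTanimoto2024, §3.1 (3.10)] -/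
def IsTangent (X : Site L n₁ → su2) (U : Conf L n₁) : Prop :=
  ∀ y : CSite n₁, HasDerivAt (fun t : ℝ => (avg (flow X t U) y).val) 0 0

/-- `U` is a **critical point of `𝒜` with the constraint `𝒞(U) = V`**: it satisfies the constraint and `(𝓛_X 𝒜)(U) = 0` for
every `X` tangent to the constraint manifold at `U` ((3.9)–(3.10)). [cite: DybalskiStottmeisterTanimoto2024, §3.1 (3.9)–(3.10); Theorem 1 §1.1] -/
def IsConstrainedCritical (V : CConf n₁) (U : Conf L n₁) : Prop :=
  avg U = V ∧ ∀ X : Site L n₁ → su2, IsTangent X U → lieDeriv X action U = 0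

/-- **THEOREM 1** (§1.1), TYPED: *«Let `G₀ = SU(2)`. Then there exist `0 < ε, ε₁ ≤ 1` s.t. for `V ∈ Conf_{ε₁}(Ω₁)` the action `𝒜`
has a unique critical point over `Conf_ε(Ω)` with the constraint `𝒞(U) = V`. The parameters `ε, ε₁` are independent of `n`
but may depend on `L`.»*  (`L > 1` odd as in §1.1; `ε, ε₁` are chosen before the volume `n = L·n₁`.)  Statement only — its
proof (§§2–4 + App. A, B of the paper) is the object of the files `DST24Configurations`, … of this directory.
[cite: DybalskiStottmeisterTanimoto2024, Theorem 1 §1.1] -/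
def Theorem1 (L : ℕ) : Prop :=
  Odd L → 1 < L → ∃ ε ε₁ : ℝ, 0 < ε ∧ ε ≤ 1 ∧ 0 < ε₁ ∧ ε₁ ≤ 1 ∧
    ∀ n₁ : ℕ, ∀ V : CConf n₁, V ∈ smallFieldC ε₁ →
      ∃! U : Conf L n₁, U ∈ smallField ε ∧ IsConstrainedCritical V U

end

end Literature.MathematicalPhysics.QuantumFieldTheory.DybalskiStottmeisterTanimoto2024.DST24Setting
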